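import Literature.NumberTheory.PAdicHodge.EisensteinRootDatum
import Literature.NumberTheory.PAdicHodge.FontaineThetaGalois
import HarnessLib

/-!
# The ramified Fontaine ring `A_inf(𝒪) = 𝔸_inf(F)[ϖ]` of an Eisenstein root `ϖ ∈ F`: ring, `Γ_F`-action, `θ_𝒪`,
# and the embedding into `B_dR⁺(F)`

Topic `Literature/NumberTheory/PAdicHodge`; sequel of `EisensteinRootDatum` (`D = (f, ϖ)`), `BdRPlusEmbedding`
(`F ↪ B_dR⁺(F)`), `FontaineThetaGalois` (`𝕎(σ♭)`), `CyclotomicTilt` (`ℤ_p → 𝔸_inf(F)`).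

Fontaine's ring `𝔸_inf(F) = 𝕎(𝒪_{ℂ_F}♭)` receives `ℤ_p` but NOT the ring of integers of a ramified `p`-adic field:
a formal group with good reduction over a RAMIFIED base has its coefficients in `𝒪 = ℤ_p[ϖ]`, `ϖ` a root of an
Eisenstein polynomial `f ∈ ℤ_p[X]`, and its points with values in Fontaine's rings live in the base-changed ring
`A_inf(𝒪) := 𝒪 ⊗_{ℤ_p} 𝔸_inf(F) = 𝔸_inf(F)[X]/(f) = 𝔸_inf(F)[ϖ]` — the ramified Witt ring `W_{𝒪_E}` of
Fargues–Fontaine (Astérisque 406, §1.2: `W_{𝒪_E}(A) = 𝒪_E ⊗_{W(𝔽_q)} W(A)` for a perfect `𝔽_q`-algebra `A`; here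
`E = ℚ_p(ϖ)` is totally ramified over `ℚ_p`, so `W(𝔽_q) = ℤ_p`). For an Eisenstein root datum `D` over `F`:

* §2 `AinfRam D = AdjoinRoot (f ⊗ 𝔸_inf(F))` (Mathlib `AdjoinRoot`), a free `𝔸_inf(F)`-algebra with power basis
  `1, ϖ, …, ϖ^{e-1}` (`AinfRam.powerBasis`); ring homomorphisms out of it are determined on `𝔸_inf(F)` and `ϖ`
  (`ringHom_ext`); the coefficient map `𝒪_D → A_inf(𝒪)` (`coeffHom`).
* §3 **the action of `Γ_F`** (`AinfRam.gal`: `𝕎(σ♭)` on `𝔸_inf`, `ϖ ↦ ϖ` since `ϖ ∈ F`), a `MulSemiringAction`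
  fixing `𝒪_D`.
* §4 **`θ_𝒪 : A_inf(𝒪) → 𝒪_{ℂ_F}`** (`AinfRam.theta`: Fontaine's `θ` on `𝔸_inf`, `ϖ ↦ ϖ`), surjective, compatible
  with `𝒪_D → F ⊆ ℂ_F`, `Γ_F`-equivariant.
* §5 **`ι_𝒪 : A_inf(𝒪) → B_dR⁺(F)`** (`AinfRam.toBdR`: `𝔸_inf → B_dR⁺` and the Hensel embedding `F ↪ B_dR⁺` of
  `BdRPlusEmbedding` on `ϖ`), with `θ_dR ∘ ι_𝒪 = θ_𝒪`, `σ ∘ ι_𝒪 = ι_𝒪 ∘ σ`, `ι_𝒪|_{𝒪_D} = (F ↪ B_dR⁺)|_{𝒪_D}`.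

The structure of `ker θ_𝒪` (principal, generated by the degree-one primitive element `ϖ − [ϖ♭]`,
Fargues–Fontaine §2.2), the `(p, ξ)`-adic completeness and the injectivity of `ι_𝒪` are sequels. Definitions
(reviewed): `EisensteinRoot.polyAinf`, `AinfRam` (+ `.varpi`, `.powerBasis`, `.coeffHom`, `.gal`, `.theta`, `.toBdR`)
and the `MulSemiringAction` instance of `Γ_F` on the new type `AinfRam D`. No named facts, no `sorry`.
Infrastructure for the supersingular sector of `isDeRham_restrictedRationalTateRep` (hDR) over a ramified base;
nothing about elliptic curves is proved here.
-- TODO(general form): for `F` with residue degree `> 1` over `ℚ_p` the natural ring is `𝒪_F ⊗_{W(k_F)} 𝔸_inf(F)`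
-- (Eisenstein polynomial over `W(k_F)`); only the `ℤ_p`-coefficient case is constructed here.

## References
* [FarguesFontaine2018] L. Fargues, J.-M. Fontaine, *Courbes et fibrés vectoriels en théorie de Hodge p-adique*,
  Astérisque 406 (2018), §1.2 (ramified Witt vectors `W_{𝒪_E} = 𝒪_E ⊗ W`), §2.2 (`θ`, primitive elements of degree 1).
* [FontaineAsterisque223III] J.-M. Fontaine, *Le corps des périodes p-adiques*, Astérisque 223 (1994), Exp. II §1.2, §1.5.
* [FontaineOuyang2022] J.-M. Fontaine, Y. Ouyang, *Theory of p-adic Galois representations*, §4.4, Prop. 5.1.7.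
-/

noncomputable section

open ValuativeRel Field Ideal WittVector Polynomial

namespace Literature.NumberTheory.PAdicHodge

open Literature.NumberTheory.GaloisRepresentations
open Literature.NumberTheory.GaloisRepresentations.IsNonarchimedeanLocalField

variable {F : Type} [Field F] [ValuativeRel F] [TopologicalSpace F] [IsNonarchimedeanLocalField F]
  [CharZero F] {p : ℕ} [Fact p.Prime]

/-! ## §2 The ring `A_inf(𝒪) = 𝔸_inf(F)[X]/(f)` -/

section Ring

variable [Fact (¬ IsUnit (p : integerC F))] {hp : valuation F p < 1}

namespace EisensteinRoot

variable (D : EisensteinRoot F p hp)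

/-- `f ⊗ 𝔸_inf(F)`: the Eisenstein polynomial with its coefficients pushed along `ℤ_p → 𝔸_inf(F)` (tree `zpToAinf`).
[cite: FarguesFontaine2018, §1.2] -/
def polyAinf : (Ainf (p := p) F)[X] := D.poly.map (zpToAinf : ℤ_[p] →+* Ainf (p := p) F)

/-- Unfolding `polyAinf`. [cite: FarguesFontaine2018, §1.2] -/
theorem polyAinf_def : D.polyAinf = D.poly.map (zpToAinf : ℤ_[p] →+* Ainf (p := p) F) := rfl

/-- Evaluating `f ⊗ 𝔸_inf` is evaluating `f` along the composite coefficient map. [cite: FarguesFontaine2018, §1.2] -/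
theorem eval₂_polyAinf {S : Type*} [CommRing S] (g : Ainf (p := p) F →+* S) (x : S) :
    D.polyAinf.eval₂ g x = D.poly.eval₂ (g.comp zpToAinf) x := by
  rw [polyAinf_def, Polynomial.eval₂_map]

/-- `f ⊗ 𝔸_inf` is monic. [cite: FarguesFontaine2018, §1.2] -/
theorem monic_polyAinf : D.polyAinf.Monic := D.monic.map _

/-- `deg (f ⊗ 𝔸_inf) = e`. [cite: FarguesFontaine2018, §1.2] -/
theorem natDegree_polyAinf : D.polyAinf.natDegree = D.e := by
  rw [polyAinf_def, D.monic.natDegree_map, e_def]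

end EisensteinRoot

/-- **The ramified Fontaine ring `A_inf(𝒪) = 𝔸_inf(F)[X]/(f) = 𝒪_D ⊗_{ℤ_p} 𝔸_inf(F) = 𝔸_inf(F)[ϖ]`** of the Eisenstein
root datum `D = (f, ϖ)` (Mathlib `AdjoinRoot` of `f ⊗ 𝔸_inf(F)`): Fargues–Fontaine's ramified Witt ring
`W_{𝒪_E}(𝒪_{ℂ_F}♭) = 𝒪_E ⊗_{ℤ_p} W(𝒪_{ℂ_F}♭)` for the totally ramified `E = ℚ_p(ϖ)`.
[cite: FarguesFontaine2018, §1.2] -/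
abbrev AinfRam (D : EisensteinRoot F p hp) : Type := AdjoinRoot D.polyAinf

namespace AinfRam

variable (D : EisensteinRoot F p hp)

/-- **`ϖ ∈ A_inf(𝒪)`**: the class of `X`. [cite: FarguesFontaine2018, §1.2] -/
def varpi : AinfRam D := AdjoinRoot.root D.polyAinf

/-- The structure map `𝔸_inf(F) → A_inf(𝒪)` is `AdjoinRoot.of`. [cite: FarguesFontaine2018, §1.2] -/
theorem algebraMap_eq : algebraMap (Ainf (p := p) F) (AinfRam D) = AdjoinRoot.of D.polyAinf := rfl

/-- `f(ϖ) = 0` in `A_inf(𝒪)`. [cite: FarguesFontaine2018, §1.2] -/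
theorem eval₂_varpi : D.polyAinf.eval₂ (algebraMap (Ainf (p := p) F) (AinfRam D)) (varpi D) = 0 :=
  AdjoinRoot.eval₂_root _

/-- `f(ϖ) = 0` in `A_inf(𝒪)`, coefficients from `ℤ_p`. [cite: FarguesFontaine2018, §1.2] -/
theorem eval₂_varpi' :
    D.poly.eval₂ ((algebraMap (Ainf (p := p) F) (AinfRam D)).comp zpToAinf) (varpi D) = 0 := by
  rw [← EisensteinRoot.eval₂_polyAinf]; exact eval₂_varpi D

/-- The class of a polynomial is its value at `ϖ`. [cite: FarguesFontaine2018, §1.2] -/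
theorem mk_eq_eval₂ (q : (Ainf (p := p) F)[X]) :
    AdjoinRoot.mk D.polyAinf q = q.eval₂ (algebraMap (Ainf (p := p) F) (AinfRam D)) (varpi D) := by
  rw [← AdjoinRoot.aeval_eq, Polynomial.aeval_def]; rfl

/-- **Ring homomorphisms out of `A_inf(𝒪)` are determined on `𝔸_inf(F)` and on `ϖ`.** [cite: FarguesFontaine2018, §1.2] -/
theorem ringHom_ext {S : Type*} [Semiring S] {g h : AinfRam D →+* S}
    (h_of : ∀ a : Ainf (p := p) F, g (algebraMap (Ainf (p := p) F) (AinfRam D) a) = h (algebraMap (Ainf (p := p) F) (AinfRam D) a))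
    (h_root : g (varpi D) = h (varpi D)) : g = h := by
  refine RingHom.ext fun x => ?_
  induction x using AdjoinRoot.induction_on with
  | ih q =>
    rw [mk_eq_eval₂, Polynomial.hom_eval₂, Polynomial.hom_eval₂, h_root]
    congr 1
    exact RingHom.ext h_of

/-- **The power basis `1, ϖ, …, ϖ^{e-1}` of `A_inf(𝒪)` over `𝔸_inf(F)`** (Mathlib `AdjoinRoot.powerBasis'` for the monic
`f ⊗ 𝔸_inf`): `A_inf(𝒪)` is a free `𝔸_inf(F)`-module of rank `e`. [cite: FarguesFontaine2018, §1.2] -/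
def powerBasis : PowerBasis (Ainf (p := p) F) (AinfRam D) := AdjoinRoot.powerBasis' D.monic_polyAinf

/-- The generator of the power basis is `ϖ`. [cite: FarguesFontaine2018, §1.2] -/
@[simp] theorem powerBasis_gen : (powerBasis D).gen = varpi D := AdjoinRoot.powerBasis'_gen D.monic_polyAinf

/-- The rank of `A_inf(𝒪)` over `𝔸_inf(F)` is `e`. [cite: FarguesFontaine2018, §1.2] -/
@[simp] theorem powerBasis_dim : (powerBasis D).dim = D.e := by
  rw [powerBasis, AdjoinRoot.powerBasis'_dim, D.natDegree_polyAinf]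

/-- The basis vectors are the powers `ϖ^i`. [cite: FarguesFontaine2018, §1.2] -/
theorem powerBasis_basis_apply (i : Fin (powerBasis D).dim) : (powerBasis D).basis i = varpi D ^ (i : ℕ) := by
  rw [PowerBasis.coe_basis, powerBasis_gen]

/-- **`𝒪_D → A_inf(𝒪)`, `X ↦ ϖ`** (`ℤ_p → 𝔸_inf(F)` on coefficients). [cite: FarguesFontaine2018, §1.2] -/
def coeffHom : D.Coeff →+* AinfRam D :=
  AdjoinRoot.lift ((algebraMap (Ainf (p := p) F) (AinfRam D)).comp zpToAinf) (varpi D) (eval₂_varpi' D)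

/-- `𝒪_D → A_inf(𝒪)` on `ℤ_p`. [cite: FarguesFontaine2018, §1.2] -/
@[simp] theorem coeffHom_of (z : ℤ_[p]) :
    coeffHom D (AdjoinRoot.of D.poly z) = algebraMap (Ainf (p := p) F) (AinfRam D) (zpToAinf z) := AdjoinRoot.lift_of _

/-- `𝒪_D → A_inf(𝒪)` on `X`. [cite: FarguesFontaine2018, §1.2] -/
@[simp] theorem coeffHom_root : coeffHom D (AdjoinRoot.root D.poly) = varpi D := AdjoinRoot.lift_root _

/-! ## §3 The action of `Γ_F` -/

omit [CharZero F] in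
/-- `𝕎(σ♭)` fixes the coefficients `ℤ_p ⊆ 𝔸_inf(F)` (tree `galAinf_zpToAinf`), as ring homomorphisms. [cite: FontaineAsterisque223III, Exp. II §1.2] -/
theorem galAinf_comp_zpToAinf (σ : absoluteGaloisGroup F) :
    (galAinf σ).comp (zpToAinf : ℤ_[p] →+* Ainf (p := p) F) = zpToAinf := RingHom.ext (galAinf_zpToAinf σ)

/-- **The action of `σ ∈ Γ_F` on `A_inf(𝒪)`**: `𝕎(σ♭)` on `𝔸_inf(F)` and `σ(ϖ) = ϖ` (`ϖ ∈ F` is fixed by `Γ_F`; well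
defined since `σ` fixes the coefficients of `f`). [cite: FarguesFontaine2018, §1.2] [cite: FontaineAsterisque223III, Exp. II §1.2] -/
def gal (σ : absoluteGaloisGroup F) : AinfRam D →+* AinfRam D :=
  AdjoinRoot.lift ((algebraMap (Ainf (p := p) F) (AinfRam D)).comp (galAinf σ)) (varpi D) (by
    rw [EisensteinRoot.eval₂_polyAinf, RingHom.comp_assoc, galAinf_comp_zpToAinf]
    exact eval₂_varpi' D)

/-- `σ` on `𝔸_inf(F) ⊆ A_inf(𝒪)`. [cite: FontaineAsterisque223III, Exp. II §1.2] -/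
@[simp] theorem gal_algebraMap (σ : absoluteGaloisGroup F) (a : Ainf (p := p) F) :
    gal D σ (algebraMap (Ainf (p := p) F) (AinfRam D) a) = algebraMap (Ainf (p := p) F) (AinfRam D) (galAinf σ a) :=
  AdjoinRoot.lift_of _

/-- **`σ(ϖ) = ϖ`.** [cite: FarguesFontaine2018, §1.2] -/
@[simp] theorem gal_varpi (σ : absoluteGaloisGroup F) : gal D σ (varpi D) = varpi D := AdjoinRoot.lift_root _

/-- `1 ∈ Γ_F` acts trivially. [cite: FontaineAsterisque223III, Exp. II §1.2] -/
theorem gal_one (x : AinfRam D) : gal D 1 x = x := by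
  have h : gal D 1 = RingHom.id _ :=
    ringHom_ext D (fun a => by rw [gal_algebraMap, galAinf_one]; rfl) (by rw [gal_varpi]; rfl)
  rw [h]; rfl

/-- `(στ)` acts as `σ ∘ τ`. [cite: FontaineAsterisque223III, Exp. II §1.2] -/
theorem gal_mul (σ τ : absoluteGaloisGroup F) (x : AinfRam D) : gal D (σ * τ) x = gal D σ (gal D τ x) := by
  have h : gal D (σ * τ) = (gal D σ).comp (gal D τ) :=
    ringHom_ext D (fun a => by rw [RingHom.comp_apply, gal_algebraMap, gal_algebraMap, gal_algebraMap, galAinf_mul])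
      (by rw [RingHom.comp_apply, gal_varpi, gal_varpi, gal_varpi])
  rw [h]; rfl

/-- **`Γ_F` acts on `A_inf(𝒪)` by ring automorphisms.** [cite: FarguesFontaine2018, §1.2] -/
instance instMulSemiringAction : MulSemiringAction (absoluteGaloisGroup F) (AinfRam D) where
  smul σ x := gal D σ x
  one_smul := gal_one D
  mul_smul := gal_mul D
  smul_zero σ := map_zero (gal D σ)
  smul_add σ := map_add (gal D σ)
  smul_one σ := map_one (gal D σ)
  smul_mul σ := map_mul (gal D σ)

/-- Unfolding the action. [cite: FontaineAsterisque223III, Exp. II §1.2] -/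
theorem smul_def (σ : absoluteGaloisGroup F) (x : AinfRam D) : σ • x = gal D σ x := rfl

/-- `Γ_F` fixes the coefficient ring `𝒪_D ⊆ A_inf(𝒪)`. [cite: FarguesFontaine2018, §1.2] -/
theorem gal_coeffHom (σ : absoluteGaloisGroup F) (x : D.Coeff) : gal D σ (coeffHom D x) = coeffHom D x := by
  have h : (gal D σ).comp (coeffHom D) = coeffHom D := by
    refine Ideal.Quotient.ringHom_ext (Polynomial.ringHom_ext' (RingHom.ext fun z => ?_) ?_)
    · change gal D σ (coeffHom D (AdjoinRoot.of D.poly z)) = coeffHom D (AdjoinRoot.of D.poly z)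
      rw [coeffHom_of, gal_algebraMap, galAinf_zpToAinf]
    · change gal D σ (coeffHom D (AdjoinRoot.root D.poly)) = coeffHom D (AdjoinRoot.root D.poly)
      rw [coeffHom_root, gal_varpi]
  exact RingHom.congr_fun h x

/-! ## §4 `θ_𝒪 : A_inf(𝒪) → 𝒪_{ℂ_F}` -/

variable [IsAdicComplete (Ideal.span {(p : integerC F)}) (integerC F)]

/-- `θ ∘ (ℤ_p → 𝔸_inf) = (ℤ_p → 𝒪_{ℂ_F})` as ring homomorphisms (tree `fontaineTheta_zpToAinf`). [cite: FontaineAsterisque223III, Exp. II §1.2.2] -/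
theorem fontaineTheta_comp_zpToAinf :
    (fontaineTheta (integerC F) p).comp (zpToAinf : ℤ_[p] →+* Ainf (p := p) F) = toIntC hp :=
  RingHom.ext (fontaineTheta_zpToAinf hp)

/-- **`θ_𝒪 : A_inf(𝒪) → 𝒪_{ℂ_F}`**: Fontaine's `θ` on `𝔸_inf(F)` and `ϖ ↦ ϖ` (well defined since `f(ϖ) = 0` in
`𝒪_{ℂ_F}`). [cite: FarguesFontaine2018, §2.2] [cite: FontaineAsterisque223III, Exp. II §1.2.2] -/
def theta : AinfRam D →+* integerC F :=
  AdjoinRoot.lift (fontaineTheta (integerC F) p) D.rootC (by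
    rw [EisensteinRoot.eval₂_polyAinf, fontaineTheta_comp_zpToAinf]
    exact D.eval₂_toIntC_rootC)

/-- `θ_𝒪` extends `θ`. [cite: FontaineAsterisque223III, Exp. II §1.2.2] -/
@[simp] theorem theta_algebraMap (a : Ainf (p := p) F) :
    theta D (algebraMap (Ainf (p := p) F) (AinfRam D) a) = fontaineTheta (integerC F) p a := AdjoinRoot.lift_of _

/-- **`θ_𝒪(ϖ) = ϖ`.** [cite: FarguesFontaine2018, §2.2] -/
@[simp] theorem theta_varpi : theta D (varpi D) = D.rootC := AdjoinRoot.lift_root _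

/-- `θ_𝒪(ϖ) = ϖ` in `ℂ_F`. [cite: FarguesFontaine2018, §2.2] -/
theorem coe_theta_varpi : ((theta D (varpi D) : integerC F) : CompletedAlgClosure F) = algebraMap F (CompletedAlgClosure F) D.root := by
  rw [theta_varpi, EisensteinRoot.coe_rootC]

/-- `θ_𝒪` is surjective (already `θ` is, tree `surjective_fontaineTheta_integerC`). [cite: FontaineAsterisque223III, Exp. II §1.2.2] -/
theorem theta_surjective (hθ : Function.Surjective (fontaineTheta (integerC F) p)) : Function.Surjective (theta D) :=
  fun y => by obtain ⟨a, ha⟩ := hθ y; exact ⟨algebraMap _ _ a, by rw [theta_algebraMap, ha]⟩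

/-- **`θ_𝒪 ∘ (𝒪_D → A_inf(𝒪)) = (𝒪_D → F ⊆ ℂ_F)`**: the coefficient ring is embedded compatibly. [cite: FarguesFontaine2018, §2.2] -/
theorem coe_theta_coeffHom (x : D.Coeff) :
    ((theta D (coeffHom D x) : integerC F) : CompletedAlgClosure F) = algebraMap F (CompletedAlgClosure F) (EisensteinRoot.Coeff.toF D x) := by
  have h : ((integerC F).subtype.comp ((theta D).comp (coeffHom D))) =
      (algebraMap F (CompletedAlgClosure F)).comp (EisensteinRoot.Coeff.toF D) := by
    refine Ideal.Quotient.ringHom_ext (Polynomial.ringHom_ext' (RingHom.ext fun z => ?_) ?_)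
    · change ((theta D (coeffHom D (AdjoinRoot.of D.poly z)) : integerC F) : CompletedAlgClosure F) =
        algebraMap F (CompletedAlgClosure F) (EisensteinRoot.Coeff.toF D (AdjoinRoot.of D.poly z))
      rw [coeffHom_of, theta_algebraMap, EisensteinRoot.Coeff.toF_of, fontaineTheta_zpToAinf hp, algebraMap_zpToF]
    · change ((theta D (coeffHom D (AdjoinRoot.root D.poly)) : integerC F) : CompletedAlgClosure F) =
        algebraMap F (CompletedAlgClosure F) (EisensteinRoot.Coeff.toF D (AdjoinRoot.root D.poly))
      rw [coeffHom_root, theta_varpi, EisensteinRoot.Coeff.toF_root, EisensteinRoot.coe_rootC]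
  exact RingHom.congr_fun h x

/-- **`θ_𝒪` is `Γ_F`-equivariant**: `θ_𝒪(σ x) = σ(θ_𝒪 x)` in `ℂ_F` (tree `fontaineTheta_galAinf` and `σ ϖ = ϖ`).
[cite: FontaineAsterisque223III, Exp. II §1.2] -/
theorem coe_theta_gal (σ : absoluteGaloisGroup F) (x : AinfRam D) :
    ((theta D (gal D σ x) : integerC F) : CompletedAlgClosure F) = σ • ((theta D x : integerC F) : CompletedAlgClosure F) := by
  have h : (integerC F).subtype.comp ((theta D).comp (gal D σ)) =
      (CompletedAlgClosure.galRingHom σ).comp ((integerC F).subtype.comp (theta D)) := by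
    refine ringHom_ext D (fun a => ?_) ?_
    · change ((theta D (gal D σ (algebraMap _ _ a)) : integerC F) : CompletedAlgClosure F) =
        CompletedAlgClosure.galRingHom σ ((theta D (algebraMap _ _ a) : integerC F) : CompletedAlgClosure F)
      rw [gal_algebraMap, theta_algebraMap, theta_algebraMap, fontaineTheta_galAinf, coe_galInt]; rfl
    · change ((theta D (gal D σ (varpi D)) : integerC F) : CompletedAlgClosure F) =
        CompletedAlgClosure.galRingHom σ ((theta D (varpi D) : integerC F) : CompletedAlgClosure F)
      rw [gal_varpi, theta_varpi]
      exact (D.smul_coe_rootC σ).symm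
  exact RingHom.congr_fun h x

/-- `Γ_F` preserves `ker θ_𝒪`. [cite: FontaineAsterisque223III, Exp. II §1.2] -/
theorem theta_gal_eq_zero (σ : absoluteGaloisGroup F) {x : AinfRam D} (hx : theta D x = 0) : theta D (gal D σ x) = 0 := by
  apply Subtype.ext
  rw [coe_theta_gal, hx, ZeroMemClass.coe_zero, smul_zero]

/-! ## §5 `ι_𝒪 : A_inf(𝒪) → B_dR⁺(F)` -/

/-- `𝔸_inf → B_dR⁺` and `F ↪ B_dR⁺` agree on `ℤ_p` (both are `ℚ_p → B_dR⁺` there). [cite: FontaineAsterisque223III, Exp. II §1.5.3] -/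
theorem ainfToBdR_comp_zpToAinf (hF : Function.Surjective (fontaineTheta (integerC F) p)) :
    (ainfToBdR.comp zpToAinf : ℤ_[p] →+* BDeRhamPlus (integerC F) p) = (embBdRHom hp hF).comp (zpToF hp) := by
  refine RingHom.ext fun z => ?_
  change ainfToBdR (zpToAinf z : Ainf (p := p) F) = embBdRHom hp hF (zpToF hp z)
  rw [zpToF_apply, embBdRHom_algebraMap, PadicBase.toPadic_ofPadicInt, qpToBdR_coe]

/-- **`ι_𝒪 : A_inf(𝒪) → B_dR⁺(F)`**: `𝔸_inf(F) → B_dR⁺(F)` on coefficients and `ϖ ↦` the Hensel lift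
`embBdRHom ϖ ∈ B_dR⁺` of `BdRPlusEmbedding` (well defined: `f(embBdRHom ϖ) = embBdRHom(f(ϖ)) = 0`).
[cite: FontaineAsterisque223III, Exp. II §1.5.3] [cite: FontaineOuyang2022, Prop. 5.1.7] -/
def toBdR (hF : Function.Surjective (fontaineTheta (integerC F) p)) : AinfRam D →+* BDeRhamPlus (integerC F) p :=
  AdjoinRoot.lift ainfToBdR (embBdRHom hp hF D.root) (by
    rw [EisensteinRoot.eval₂_polyAinf, ainfToBdR_comp_zpToAinf (hp := hp) hF, ← Polynomial.hom_eval₂, D.eval₂_root,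
      map_zero])

/-- `ι_𝒪` extends `𝔸_inf → B_dR⁺`. [cite: FontaineAsterisque223III, Exp. II §1.5.3] -/
@[simp] theorem toBdR_algebraMap (hF : Function.Surjective (fontaineTheta (integerC F) p)) (a : Ainf (p := p) F) :
    toBdR D hF (algebraMap (Ainf (p := p) F) (AinfRam D) a) = ainfToBdR a := AdjoinRoot.lift_of _

/-- `ι_𝒪(ϖ)` is the Hensel lift of `ϖ`. [cite: FontaineAsterisque223III, Exp. II §1.5.3] -/
@[simp] theorem toBdR_varpi (hF : Function.Surjective (fontaineTheta (integerC F) p)) :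
    toBdR D hF (varpi D) = embBdRHom hp hF D.root := AdjoinRoot.lift_root _

/-- **`θ_dR ∘ ι_𝒪 = θ_𝒪`.** [cite: FontaineAsterisque223III, Exp. II §1.5.2–§1.5.3] -/
theorem thetaBdR_toBdR (hF : Function.Surjective (fontaineTheta (integerC F) p)) (x : AinfRam D) :
    thetaBdR (toBdR D hF x) = ((theta D x : integerC F) : CompletedAlgClosure F) := by
  have h : (thetaBdR (F := F) (p := p)).comp (toBdR D hF) = (integerC F).subtype.comp (theta D) := by
    refine ringHom_ext D (fun a => ?_) ?_
    · change thetaBdR (toBdR D hF (algebraMap _ _ a)) = ((theta D (algebraMap _ _ a) : integerC F) : CompletedAlgClosure F)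
      rw [toBdR_algebraMap, theta_algebraMap, thetaBdR_ainfToBdR]
    · change thetaBdR (toBdR D hF (varpi D)) = ((theta D (varpi D) : integerC F) : CompletedAlgClosure F)
      rw [toBdR_varpi, thetaBdR_embBdRHom, coe_theta_varpi]
  exact RingHom.congr_fun h x

/-- **`ι_𝒪` is `Γ_F`-equivariant**: `σ(ι_𝒪 x) = ι_𝒪(σ x)`. [cite: FontaineAsterisque223III, Exp. II §1.5.3] -/
theorem galBdRPlus_toBdR (hF : Function.Surjective (fontaineTheta (integerC F) p)) (σ : absoluteGaloisGroup F) (x : AinfRam D) :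
    galBdRPlus σ (toBdR D hF x) = toBdR D hF (gal D σ x) := by
  have h : (galBdRPlus σ).comp (toBdR D hF) = (toBdR D hF).comp (gal D σ) := by
    refine ringHom_ext D (fun a => ?_) ?_
    · change galBdRPlus σ (toBdR D hF (algebraMap _ _ a)) = toBdR D hF (gal D σ (algebraMap _ _ a))
      rw [toBdR_algebraMap, gal_algebraMap, toBdR_algebraMap, galBdRPlus_ainfToBdR]
    · change galBdRPlus σ (toBdR D hF (varpi D)) = toBdR D hF (gal D σ (varpi D))
      rw [toBdR_varpi, gal_varpi, toBdR_varpi, galBdRPlus_embBdRHom]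
  exact RingHom.congr_fun h x

/-- **`ι_𝒪 ∘ (𝒪_D → A_inf(𝒪)) = (F ↪ B_dR⁺) ∘ (𝒪_D → F)`**: on the coefficient ring `ι_𝒪` is the embedding of `F`.
[cite: FontaineAsterisque223III, Exp. II §1.5.3] -/
theorem toBdR_coeffHom (hF : Function.Surjective (fontaineTheta (integerC F) p)) (x : D.Coeff) :
    toBdR D hF (coeffHom D x) = embBdRHom hp hF (EisensteinRoot.Coeff.toF D x) := by
  have h : (toBdR D hF).comp (coeffHom D) = (embBdRHom hp hF).comp (EisensteinRoot.Coeff.toF D) := by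
    refine Ideal.Quotient.ringHom_ext (Polynomial.ringHom_ext' (RingHom.ext fun z => ?_) ?_)
    · change toBdR D hF (coeffHom D (AdjoinRoot.of D.poly z)) = embBdRHom hp hF (EisensteinRoot.Coeff.toF D (AdjoinRoot.of D.poly z))
      rw [coeffHom_of, toBdR_algebraMap, EisensteinRoot.Coeff.toF_of]
      exact RingHom.congr_fun (ainfToBdR_comp_zpToAinf (hp := hp) hF) z
    · change toBdR D hF (coeffHom D (AdjoinRoot.root D.poly)) = embBdRHom hp hF (EisensteinRoot.Coeff.toF D (AdjoinRoot.root D.poly))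
      rw [coeffHom_root, toBdR_varpi, EisensteinRoot.Coeff.toF_root]
  exact RingHom.congr_fun h x

/-- `ι_𝒪` maps `ker θ_𝒪` into `ker θ_dR = Fil¹ B_dR⁺`. [cite: FontaineAsterisque223III, Exp. II §1.5.2] -/
theorem thetaBdR_toBdR_eq_zero (hF : Function.Surjective (fontaineTheta (integerC F) p)) {x : AinfRam D} (hx : theta D x = 0) :
    thetaBdR (toBdR D hF x) = 0 := by
  rw [thetaBdR_toBdR, hx]; rfl

/-- `ι_𝒪(ker θ_𝒪) ⊆ ξ_dR B_dR⁺`. [cite: FontaineAsterisque223III, Exp. II §1.5.2] -/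
theorem toBdR_mem_span_xiBdR (hF : Function.Surjective (fontaineTheta (integerC F) p)) {x : AinfRam D} (hx : theta D x = 0) :
    toBdR D hF x ∈ Ideal.span {(xiBdR : BDeRhamPlus (integerC F) p)} :=
  (mem_ker_thetaBdR_iff _).1 (thetaBdR_toBdR_eq_zero D hF hx)

end AinfRam

end Ring

end Literature.NumberTheory.PAdicHodge

end
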